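import Summits.HodgeConjecture.HodgeConjecture.Theorems.EndoscopicMiddleDegreeAlgebraicOrEnvelopedOfCoreHodgeClassesAlgebraic
import Summits.HodgeConjecture.HodgeConjecture.Theorems.EndoscopicMiddleDegreeOrthogonalEnvelopedHeckeGraphChowHodgeType
import Literature.AlgebraicGeometry.HodgeTheory.AlgebraicClassesHodgeType
import HarnessLib

/-!
# Crux `AlgebraicOrEnveloped` (stmt-HodgeConjecture-14943), line `core-splitting-ladder`: the coniveau debt in its PURE case

The registered skeleton of line `core-splitting-ladder` (rev 5; durable form
`Theorems/EndoscopicMiddleDegreeAlgebraicOrEnvelopedOfCoreHodgeClassesAlgebraic`, p117869) closes the crux modulo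
`Grothendieck1969_supportedClasses_le_hodgeConiveau` (Grothendieck's coniveau remark `Nᵖ Hᵏ ⊆ Fᵖ Hᵏ`, a Literature
named fact whose tree reductions all end at Deligne's mixed Hodge theory, `Deligne1974_ker_pullback_eq_ker_pullback_resolution`),
`CupProductAlgebraic` (route item stmt-HodgeConjecture-14350) and the bet (HC on Hecke cores). The coniveau remark is
consumed ONLY in its PURE CASE — algebraic classes of codimension `k` are of Hodge type `(k,k)` (Voisin I Prop. 11.20):

  `AlgebraicClassesHodge := ∀ d Y, IsSmoothProjective d Y → ∀ k x, x ∈ algebraicClasses Y k → IsOfHodgeType d Y (2k) k k x`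

(spelled out as the hypothesis `hA` below, the shape used by `orthogonalSplit_of_algebraicClasses_isOfHodgeType`), at two places:
the algebraic-kernel split (`Theorems.stub_algebraicKernelSplit`, p99326) and the Hodge-type preservation of the actions of
algebraic self-correspondences (`isOfHodgeType_corrAction_of_grothendieck`, p107349). This file re-derives both from `hA`
(`algebraicKernelSplit_of_pure`, `isOfHodgeType_corrAction_of_pure`, whence `heckeHodgeType_of_pure` and the glue
`algebraicOrEnveloped_of_algebraicKernelEnveloped_of_pure`), and concludes

* `algebraicOrEnveloped_of_coreHodgeClassesAlgebraic_of_pure` — the crux from `AlgebraicClassesHodge`, `CupProductAlgebraic`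
  and the bet (the residual `algebraicKernelEnveloped_of_coreHodgeClassesAlgebraic` of p117869 is already stated with the
  Hodge-type preservation of the Hecke algebras as its hypothesis, so only the outer glue changes);
* `algebraicOrEnveloped_of_coreHodgeClassesAlgebraic_of_fundamentalClass` — the crux from the SMALLER named fact
  `map_fundamentalClass_ne_zero_of_height_eq` (the fundamental class of a subvariety is not homologous to zero, in push-forward
  form: Fulton Lemma 19.1.2 + Wirtinger; the one input of the tree's PROOF of the pure case,
  `isOfHodgeType_of_mem_algebraicClasses`), `CupProductAlgebraic` and the bet;
* `algebraicClassesHodge_of_grothendieck` — for the record, the pure case from the coniveau remark (p107349's lemma).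

So the line's literature debt shrinks from Deligne's Hodge III to the Wirtinger non-vanishing (whose discharge is in the pipeline),
with no change to the bet. Nothing here attacks the bet; no definition, no restatement of the crux.

References: Grothendieck, Topology 8 (1969) p. 300; Voisin, Hodge Theory I §7.1.2, §7.3.2, Prop. 11.20, Thm. 6.32; Fulton,
Intersection Theory Lemma 19.1.2; Griffiths–Harris Ch. 0 §2, §7; BMM arXiv:1306.1515 Part 2 §1.9, Thm. 61.
-/

noncomputable section
set_option linter.dupNamespace false -- `Summit.<P>.<Sub>.Theorems.…` repeats `HodgeConjecture` (single-conjunct summit)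

namespace Summit.HodgeConjecture.HodgeConjecture.Theorems.EndoscopicMiddleDegreeAlgebraicOrEnvelopedPureConiveau

open scoped Manifold
open CategoryTheory MonoidalCategory CartesianMonoidalCategory
open Literature.AlgebraicGeometry.Motives (SchemeOver ComplexPoints IsSmoothProjective)
open Literature.AlgebraicGeometry.HodgeTheory
open Literature.AlgebraicGeometry.ShimuraVarieties
open Literature.AlgebraicTopology.SingularHomology
open Summit.HodgeConjecture.HodgeConjecture.Theses.EndoscopicMiddleDegree (AlgebraicOrEnveloped CupProductAlgebraic)
open Summit.HodgeConjecture.HodgeConjecture.Cruxes.MiddleThetaSpan.ConjugateDimensionSieve (IsPrimitiveCentralIdempotent)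
open Summit.HodgeConjecture.HodgeConjecture.Theorems.EndoscopicMiddleDegreeOrthogonalEnvelopedHeckeGraphChowHodgeType
  (isOfHodgeType_of_mem_algebraicClasses_of_grothendieck)
open Summit.HodgeConjecture.HodgeConjecture.Theorems.EndoscopicMiddleDegreeAlgebraicOrEnvelopedOfCoreHodgeClassesAlgebraic
  (algebraicKernelEnveloped_of_coreHodgeClassesAlgebraic)

/-! ## The pure case from either named fact -/

/-- **The pure case of the coniveau remark from the coniveau remark** (for the record; p107349's
`isOfHodgeType_of_mem_algebraicClasses_of_grothendieck`): algebraic classes of codimension `k` are of type `(k,k)`.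
[cite: GrothendieckTopology1969, p. 299 (∗) and p. 300] -/
theorem algebraicClassesHodge_of_grothendieck (hG : Grothendieck1969_supportedClasses_le_hodgeConiveau) :
    ∀ ⦃d : ℕ⦄ ⦃Y : SchemeOver ℂ⦄, IsSmoothProjective d Y →
      ∀ (k : ℕ) (x : complexBetti Y (2 * k)), x ∈ algebraicClasses Y k → IsOfHodgeType d Y (2 * k) k k x :=
  fun _ _ hY _ _ hx ↦ isOfHodgeType_of_mem_algebraicClasses_of_grothendieck hG hY hx

/-- **The pure case of the coniveau remark from the non-vanishing of fundamental classes** (the tree's proof of Voisin I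
Prop. 11.20, `isOfHodgeType_of_mem_algebraicClasses`: irreducible supports, purity of `ker (H²ᵏ(Y) → H²ᵏ(Y ∖ Z))`,
projective resolutions, the Gysin bidegree; its one named-fact input is `map_fundamentalClass_ne_zero_of_height_eq`).
[cite: VoisinHodgeI2002, §11.1.2 Prop. 11.20] [cite: Fulton1998, §19.1 Lemma 19.1.2] -/
theorem algebraicClassesHodge_of_fundamentalClass (h : map_fundamentalClass_ne_zero_of_height_eq) :
    ∀ ⦃d : ℕ⦄ ⦃Y : SchemeOver ℂ⦄, IsSmoothProjective d Y →
      ∀ (k : ℕ) (x : complexBetti Y (2 * k)), x ∈ algebraicClasses Y k → IsOfHodgeType d Y (2 * k) k k x :=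
  fun _ _ hY k _ hx ↦ isOfHodgeType_of_mem_algebraicClasses h hY k hx

/-! ## The two consumers of the coniveau remark, re-derived from its pure case -/

variable {m : ℕ} {X : SchemeOver ℂ}

/-- **The algebraic-kernel split from the pure case** (the landed `Theorems.stub_algebraicKernelSplit`, p99326, with the
coniveau remark replaced by its pure case `hA`, the Kähler package and de Rham's theorem by the tree's theorems
`hardLefschetz_hodgeRiemann_holds`, `exists_deRhamIsoFamily_holds`): granted HC in degree `2m`, every rational Hodge
`(m+1,m+1)`-class lies in `algebraicClasses X (m+1) ⊔ span_ℂ {e rational Hodge (m+1,m+1) : e ∪ algebraicClasses X (m+1) = 0}`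
— `Theorems.mem_sup_span_orthogonal` for the span `T` of the algebraic rational Hodge classes, which equals
`algebraicClasses X (m+1)` (rational supported classes span; `hA`) and contains the Lefschetz products.
[cite: VoisinHodgeI2002, §6.3.2 Thm. 6.32 and §7.1.2] -/
theorem algebraicKernelSplit_of_pure
    (hA : ∀ ⦃d : ℕ⦄ ⦃Y : SchemeOver ℂ⦄, IsSmoothProjective d Y →
      ∀ (k : ℕ) (x : complexBetti Y (2 * k)), x ∈ algebraicClasses Y k → IsOfHodgeType d Y (2 * k) k k x)
    (hcup : CupProductAlgebraic) (D : UnitaryBallQuotientDatum (2 * (m + 1)) X)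
    (hlow : ∀ a : complexBetti X (2 * m), IsRationalClass a →
      IsOfHodgeType (2 * (m + 1)) X (2 * m) m m a → a ∈ algebraicClasses X m)
    {c : complexBetti X (2 * (m + 1))} (hcQ : IsRationalClass c)
    (hcT : IsOfHodgeType (2 * (m + 1)) X (2 * (m + 1)) (m + 1) (m + 1) c) :
    c ∈ algebraicClasses X (m + 1) ⊔ Submodule.span ℂ {e : complexBetti X (2 * (m + 1)) |
      IsRationalClass e ∧ IsOfHodgeType (2 * (m + 1)) X (2 * (m + 1)) (m + 1) (m + 1) e ∧
      ∀ x ∈ algebraicClasses X (m + 1),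
        cupProduct (two_mul_add_two_mul (m + 1) (m + 1)) e x = 0} := by
  have hX : IsSmoothProjective (2 * (m + 1)) X := D.isSmoothProjective
  obtain ⟨A, hcA⟩ := hcT
  have hI : hodgePQ_independent_of_hodgeModel := hodgePQ_independent_of_hodgeModel_holds
  have hcupT : CupPreservesHodgeType (2 * (m + 1)) X :=
    cupPreservesHodgeType_of_exists_deRhamIsoFamily hI hX A
      (Literature.NumberTheory.Transcendental.exists_deRhamIsoFamily_holds A.model)
  -- algebraic classes are of Hodge type `(k,k)`: the pure case
  have hAlgT : ∀ {k : ℕ} {x : complexBetti X (2 * k)}, x ∈ algebraicClasses X k →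
      IsOfHodgeType (2 * (m + 1)) X (2 * k) k k x := fun hx ↦ hA hX _ _ hx
  -- `S`: the algebraic rational Hodge `(m+1,m+1)`-classes; `T = span S`
  set S : Set (complexBetti X (2 * (m + 1))) := {x | x ∈ algebraicClasses X (m + 1) ∧
      IsRationalClass x ∧ IsOfHodgeType (2 * (m + 1)) X (2 * (m + 1)) (m + 1) (m + 1) x}
  have hTalg : Submodule.span ℂ S ≤ algebraicClasses X (m + 1) :=
    Submodule.span_le.2 fun x hx ↦ hx.1
  have halgT : algebraicClasses X (m + 1) ≤ Submodule.span ℂ S := by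
    intro x hx
    refine Submodule.span_mono ?_
      (supportedClasses_le_span_isRationalClass hX (2 * (m + 1)) (m + 1) hx)
    rintro y ⟨hyQ, hyN⟩
    exact ⟨hyN, hyQ, hAlgT hyN⟩
  have hT1 : Submodule.span ℂ S ≤ Submodule.span ℂ {x : complexBetti X (2 * (m + 1)) |
      x ∈ Submodule.span ℂ S ∧ IsRationalClass x ∧
        IsOfHodgeType (2 * (m + 1)) X (2 * (m + 1)) (m + 1) (m + 1) x} :=
    Submodule.span_mono fun x hx ↦ ⟨Submodule.subset_span hx, hx.2⟩
  have hT2 : ∀ b : complexBetti X (2 * m), IsRationalClass b →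
      IsOfHodgeType (2 * (m + 1)) X (2 * m) m m b → ∀ d ∈ algebraicClasses X 1,
        cupProduct (two_mul_add_two_mul m 1) b d ∈ Submodule.span ℂ S := by
    intro b hbQ hbT d hd
    have hd' := supportedClasses_le_span_isRationalClass hX (2 * 1) 1 hd
    have hz := Submodule.mem_map_of_mem (f := cupProduct (two_mul_add_two_mul m 1) b) hd'
    rw [Submodule.map_span] at hz
    refine Submodule.span_mono ?_ hz
    rintro _ ⟨d', ⟨hd'Q, hd'N⟩, rfl⟩
    exact ⟨hcup hX m 1 b d' (hlow b hbQ hbT) hd'N, hbQ.cup _ hd'Q,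
      hcupT (two_mul_add_two_mul m 1) hbT (hAlgT hd'N)⟩
  have key := Theorems.mem_sup_span_orthogonal
    (show Theorems.hardLefschetz_hodgeRiemann (2 * (m + 1)) X from hardLefschetz_hodgeRiemann_holds) hX A
    (Submodule.span ℂ S) hT1 hT2 hcQ hcA
  refine SetLike.le_def.1 (sup_le_sup hTalg (Submodule.span_mono ?_)) key
  rintro e ⟨heQ, heT, horth⟩
  exact ⟨heQ, heT, fun x hx ↦ horth x (halgT hx)⟩

/-- **The action of an ALGEBRAIC self-correspondence preserves every Hodge type, from the pure case** (the landed
`isOfHodgeType_corrAction_of_grothendieck`, p107349, with `hA` for the coniveau remark): `P_γ β = pr₁₊(pr₂^* β ∪ γ)` with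
`pr₂^*` of bidegree `(0,0)`, `∪ γ` of bidegree `(n,n)` for `γ` of type `(n,n)` (`hA` on `X ⊗ X`), `pr₁₊` of bidegree
`(-n,-n)`, `n = dim X`. [cite: VoisinHodgeI2002, §7.3.2 (with Lemma 7.30) and §11.3.3] -/
theorem isOfHodgeType_corrAction_of_pure
    (hA : ∀ ⦃d : ℕ⦄ ⦃Y : SchemeOver ℂ⦄, IsSmoothProjective d Y →
      ∀ (k : ℕ) (x : complexBetti Y (2 * k)), x ∈ algebraicClasses Y k → IsOfHodgeType d Y (2 * k) k k x)
    (μ : OrientationFamily) (hX : IsSmoothProjective (2 * (m + 1)) X) {γ : complexBetti (X ⊗ X) (2 * (2 * (m + 1)))}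
    (hγ : γ ∈ algebraicClasses (X ⊗ X) (2 * (m + 1))) {p q : ℕ} {β : complexBetti X (2 * (m + 1))}
    (hβ : IsOfHodgeType (2 * (m + 1)) X (2 * (m + 1)) p q β) :
    IsOfHodgeType (2 * (m + 1)) X (2 * (m + 1)) p q
      (corrAction μ hX hX
        (rfl : 2 * (m + 1) + 2 * (2 * (m + 1)) = 2 * (m + 1) + 2 * (2 * (m + 1))) γ β) := by
  have hY := IsSmoothProjective.tensor_holds hX hX
  have hI := hodgePQ_independent_of_hodgeModel_holds
  have hM : ∀ (k : ℕ) (Z : SchemeOver ℂ), nonempty_hodgeModel k Z := fun _ _ ↦ nonempty_hodgeModel_holds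
  have hdR : ∀ (E : Type) [NormedAddCommGroup E] [NormedSpace ℂ E] [FiniteDimensional ℂ E],
      Literature.NumberTheory.Transcendental.exists_deRhamIsoFamily 𝓘(ℝ, E) :=
    fun E _ _ _ ↦ Literature.NumberTheory.Transcendental.exists_deRhamIsoFamily_holds (E := E)
  obtain ⟨B⟩ := nonempty_hodgeModel_holds.nonempty hY
  -- `pr₂^* β` is of type `(p, q)` and `γ` of type `(n, n)` on `X ⊗ X`
  have h2 : IsOfHodgeType (2 * (m + 1) + 2 * (m + 1)) (X ⊗ X) (2 * (m + 1)) p q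
      (complexBetti.map (snd X X) (2 * (m + 1)) β) :=
    hβ.map_of_independent hI hY hX B (snd X X)
  have hγt : IsOfHodgeType (2 * (m + 1) + 2 * (m + 1)) (X ⊗ X) (2 * (2 * (m + 1)))
      (2 * (m + 1)) (2 * (m + 1)) γ :=
    hA hY _ _ hγ
  -- their cup product is of type `(p + n, q + n)`
  have hcup := cupPreservesHodgeType_of_nonempty_hodgeModel hI (hM _ _) hdR hY
    (rfl : 2 * (m + 1) + 2 * (2 * (m + 1)) = 2 * (m + 1) + 2 * (2 * (m + 1))) h2 hγt
  -- and `pr₁₊` brings it back to type `(p, q)`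
  rw [corrAction_apply]
  exact isOfHodgeType_complexGysin hI hM hdR μ hY hX (fst X X) _
    (p := p + 2 * (m + 1)) (q := q + 2 * (m + 1)) (by omega) (by omega) hcup

/-- **The Hecke algebra preserves every Hodge type, from the pure case**: generators are actions of ALGEBRAIC classes
(landed `Theorems.CoreSplittingLadder.stub_heckeGraphAlgebraic`, p112869) and so preserve types (`isOfHodgeType_corrAction_of_pure`);
scalars, sums and products by `Algebra.adjoin_induction`. [cite: BergeronMillsonMoeglin2016Balls, Part 2 §1.8 and Thm. 61] -/
theorem heckeHodgeType_of_pure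
    (hA : ∀ ⦃d : ℕ⦄ ⦃Y : SchemeOver ℂ⦄, IsSmoothProjective d Y →
      ∀ (k : ℕ) (x : complexBetti Y (2 * k)), x ∈ algebraicClasses Y k → IsOfHodgeType d Y (2 * k) k k x)
    {μ : OrientationFamily} (hμ : μ.HasPoincareDuality) (D : UnitaryBallQuotientDatum (2 * (m + 1)) X)
    (hm1 : 1 ≤ m) (hm2 : m ≤ 2) {a : Module.End ℂ (complexBetti X (2 * (m + 1)))}
    (ha : a ∈ Algebra.adjoin ℂ (Set.range (D.heckeCorrespondenceAction (2 * (m + 1))))) {p q : ℕ} :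
    ∀ x : complexBetti X (2 * (m + 1)), IsOfHodgeType (2 * (m + 1)) X (2 * (m + 1)) p q x →
      IsOfHodgeType (2 * (m + 1)) X (2 * (m + 1)) p q (a x) := by
  induction ha using Algebra.adjoin_induction with
  | mem T hT =>
    obtain ⟨g, rfl⟩ := hT
    intro x hx
    obtain ⟨γ, hγ, hP⟩ := Theorems.CoreSplittingLadder.stub_heckeGraphAlgebraic μ hμ m X D hm1 hm2 g
    rw [← hP]
    exact isOfHodgeType_corrAction_of_pure hA μ D.isSmoothProjective hγ hx
  | algebraMap r =>
    intro x hx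
    rw [Module.algebraMap_end_apply]
    exact hx.smul r
  | add b b' _ _ ihb ihb' =>
    intro x hx
    rw [LinearMap.add_apply]
    exact (ihb x hx).add D.isSmoothProjective (ihb' x hx)
  | mul b b' _ _ ihb ihb' =>
    intro x hx
    rw [Module.End.mul_apply]
    exact ihb _ (ihb' x hx)

/-! ## The glue and the crux, from the pure case -/

/-- **The crux from its residual, from the pure case** (the landed glue `Theorems.algebraicOrEnveloped_of_algebraicKernelEnveloped`,
p106212, with `algebraicKernelSplit_of_pure` for the split): IF every `Alg`-orthogonal rational Hodge `(m+1,m+1)`-class is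
enveloped (`hres`, for every orientation family with Poincaré duality), THEN `AlgebraicOrEnveloped` — split along `Alg` and
envelope each generator at the complex orientation family. [cite: VoisinHodgeI2002, §6.3.2 Thm. 6.32 and §7.1.2] -/
theorem algebraicOrEnveloped_of_algebraicKernelEnveloped_of_pure
    (hA : ∀ ⦃d : ℕ⦄ ⦃Y : SchemeOver ℂ⦄, IsSmoothProjective d Y →
      ∀ (k : ℕ) (x : complexBetti Y (2 * k)), x ∈ algebraicClasses Y k → IsOfHodgeType d Y (2 * k) k k x)
    (hcup : CupProductAlgebraic)
    (hres : ∀ (μ : OrientationFamily), μ.HasPoincareDuality →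
      ∀ (m : ℕ) (X : SchemeOver ℂ) (D : UnitaryBallQuotientDatum (2 * (m + 1)) X), 1 ≤ m → m ≤ 2 →
      (∀ a : complexBetti X (2 * m), IsRationalClass a →
        IsOfHodgeType (2 * (m + 1)) X (2 * m) m m a → a ∈ algebraicClasses X m) →
      ∀ e : complexBetti X (2 * (m + 1)), IsRationalClass e →
        IsOfHodgeType (2 * (m + 1)) X (2 * (m + 1)) (m + 1) (m + 1) e →
        (∀ x ∈ algebraicClasses X (m + 1),
          cupProduct (two_mul_add_two_mul (m + 1) (m + 1)) e x = 0) →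
        ∃ γ ∈ algebraicClasses (X ⊗ X) (2 * (m + 1)),
          (∀ β, IsRationalClass β → IsRationalClass
            (corrAction μ D.isSmoothProjective D.isSmoothProjective
              (rfl : 2 * (m + 1) + 2 * (2 * (m + 1)) = 2 * (m + 1) + 2 * (2 * (m + 1))) γ β)) ∧
          (∀ β, IsOfHodgeType (2 * (m + 1)) X (2 * (m + 1)) (m + 1) (m + 1)
            (corrAction μ D.isSmoothProjective D.isSmoothProjective
              (rfl : 2 * (m + 1) + 2 * (2 * (m + 1)) = 2 * (m + 1) + 2 * (2 * (m + 1))) γ β)) ∧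
          corrAction μ D.isSmoothProjective D.isSmoothProjective
              (rfl : 2 * (m + 1) + 2 * (2 * (m + 1)) = 2 * (m + 1) + 2 * (2 * (m + 1))) γ e = e) :
    AlgebraicOrEnveloped := by
  intro m X D hm1 hm2 hlow c hc hH
  -- the complex orientation family, with Poincaré duality (Hatcher Thm. 3.30)
  obtain ⟨μ, hμ⟩ : ∃ μ : OrientationFamily, μ.HasPoincareDuality :=
    ⟨fun _ _ h ↦ Classical.choice (ComplexPoints.isOrientableOver ℂ h),
      OrientationFamily.hasPoincareDuality_of (fun ν _ _ h ↦ poincare_duality ν h) _⟩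
  refine SetLike.le_def.1 (sup_le_sup_left (Submodule.span_mono ?_) _)
    (algebraicKernelSplit_of_pure hA hcup D hlow hc hH)
  rintro e ⟨he, heH, horth⟩
  obtain ⟨γ, hγ, hrat, hhodge, hfix⟩ := hres μ hμ m X D hm1 hm2 hlow e he heH horth
  exact ⟨he, μ, hμ, γ, hγ, hrat, hhodge, hfix⟩

/-- **`AlgebraicOrEnveloped` GRANTED the pure case of the coniveau remark, `CupProductAlgebraic` and HC on Hecke cores**
(p117869's `algebraicOrEnveloped_of_coreHodgeClassesAlgebraic` with `Grothendieck1969_supportedClasses_le_hodgeConiveau`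
weakened to its pure case `hA`): the residual `algebraicKernelEnveloped_of_coreHodgeClassesAlgebraic` (p117869) fed with
`heckeHodgeType_of_pure`, then `algebraicOrEnveloped_of_algebraicKernelEnveloped_of_pure`.
[cite: BergeronMillsonMoeglin2016Balls, Part 2 §1.9 and Thm. 61] [cite: VoisinHodgeI2002, Thm. 6.32 and §7.1.2] -/
theorem algebraicOrEnveloped_of_coreHodgeClassesAlgebraic_of_pure
    (hA : ∀ ⦃d : ℕ⦄ ⦃Y : SchemeOver ℂ⦄, IsSmoothProjective d Y →
      ∀ (k : ℕ) (x : complexBetti Y (2 * k)), x ∈ algebraicClasses Y k → IsOfHodgeType d Y (2 * k) k k x)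
    (hcup : CupProductAlgebraic)
    (hCore : ∀ (m : ℕ) (X : SchemeOver ℂ) (D : UnitaryBallQuotientDatum (2 * (m + 1)) X), 1 ≤ m → m ≤ 2 →
      (∀ a : complexBetti X (2 * m), IsRationalClass a →
        IsOfHodgeType (2 * (m + 1)) X (2 * m) m m a → a ∈ algebraicClasses X m) →
      ∀ ε : Module.End ℂ (complexBetti X (2 * (m + 1))),
        ε ∈ Algebra.adjoin ℂ (Set.range (D.heckeCorrespondenceAction (2 * (m + 1)))) →
        ε * ε = ε →
        (∀ T ∈ Algebra.adjoin ℂ (Set.range (D.heckeCorrespondenceAction (2 * (m + 1)))),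
          T * ε = ε * T) →
        (∀ β, IsRationalClass β → IsRationalClass (ε β)) →
        (∀ (p q : ℕ) (x : complexBetti X (2 * (m + 1))), IsOfHodgeType (2 * (m + 1)) X (2 * (m + 1)) p q x →
          IsOfHodgeType (2 * (m + 1)) X (2 * (m + 1)) p q (ε x)) →
        (∀ f ∈ Algebra.adjoin ℂ (Set.range (D.heckeCorrespondenceAction (2 * (m + 1)))),
          f * f = f →
          (∀ T ∈ Algebra.adjoin ℂ (Set.range (D.heckeCorrespondenceAction (2 * (m + 1)))),
            T * f = f * T) →
          (∀ β, IsRationalClass β → IsRationalClass (f β)) → f * ε = 0 ∨ f * ε = ε) →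
        (∃ β, ¬ IsOfHodgeType (2 * (m + 1)) X (2 * (m + 1)) (m + 1) (m + 1) (ε β)) →
        (∃ z : Module.End ℂ (complexBetti X (2 * (m + 1))),
          IsPrimitiveCentralIdempotent
              (Algebra.adjoin ℂ (Set.range (D.heckeCorrespondenceAction (2 * (m + 1))))) z ∧
            z * ε = z ∧
              ∀ σ : ℂ ≃+* ℂ, ∃ c : complexBetti X (2 * (m + 1)),
                IsOfHodgeType (2 * (m + 1)) X (2 * (m + 1)) (m + 1) (m + 1) (conjEnd σ z c) ∧
                  conjEnd σ z c ≠ 0) →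
        ∀ e : complexBetti X (2 * (m + 1)), IsRationalClass e →
          IsOfHodgeType (2 * (m + 1)) X (2 * (m + 1)) (m + 1) (m + 1) e →
          ε e ∈ algebraicClasses X (m + 1)) :
    AlgebraicOrEnveloped :=
  algebraicOrEnveloped_of_algebraicKernelEnveloped_of_pure hA hcup fun μ hμ ↦
    algebraicKernelEnveloped_of_coreHodgeClassesAlgebraic
      (fun _ _ D hm1 hm2 _ ha _ _ x hx ↦ heckeHodgeType_of_pure hA hμ D hm1 hm2 ha x hx) hcup hCore μ hμ

/-- **`AlgebraicOrEnveloped` GRANTED the non-vanishing of fundamental classes, `CupProductAlgebraic` and HC on Hecke cores**: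
the line's coniveau debt paid down to `map_fundamentalClass_ne_zero_of_height_eq` (Fulton Lemma 19.1.2 + Wirtinger), through the
tree's proof of the pure case (`isOfHodgeType_of_mem_algebraicClasses`). Registered sub-goal of the crux item (line
`core-splitting-ladder`, rev 6). [cite: Fulton1998, §19.1 Lemma 19.1.2] [cite: VoisinHodgeI2002, §11.1.2 Prop. 11.20] -/
theorem algebraicOrEnveloped_of_coreHodgeClassesAlgebraic_of_fundamentalClass :
    map_fundamentalClass_ne_zero_of_height_eq → CupProductAlgebraic →
    (∀ (m : ℕ) (X : SchemeOver ℂ) (D : UnitaryBallQuotientDatum (2 * (m + 1)) X), 1 ≤ m → m ≤ 2 →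
      (∀ a : complexBetti X (2 * m), IsRationalClass a →
        IsOfHodgeType (2 * (m + 1)) X (2 * m) m m a → a ∈ algebraicClasses X m) →
      ∀ ε : Module.End ℂ (complexBetti X (2 * (m + 1))),
        ε ∈ Algebra.adjoin ℂ (Set.range (D.heckeCorrespondenceAction (2 * (m + 1)))) →
        ε * ε = ε →
        (∀ T ∈ Algebra.adjoin ℂ (Set.range (D.heckeCorrespondenceAction (2 * (m + 1)))),
          T * ε = ε * T) →
        (∀ β, IsRationalClass β → IsRationalClass (ε β)) →
        (∀ (p q : ℕ) (x : complexBetti X (2 * (m + 1))), IsOfHodgeType (2 * (m + 1)) X (2 * (m + 1)) p q x →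
          IsOfHodgeType (2 * (m + 1)) X (2 * (m + 1)) p q (ε x)) →
        (∀ f ∈ Algebra.adjoin ℂ (Set.range (D.heckeCorrespondenceAction (2 * (m + 1)))),
          f * f = f →
          (∀ T ∈ Algebra.adjoin ℂ (Set.range (D.heckeCorrespondenceAction (2 * (m + 1)))),
            T * f = f * T) →
          (∀ β, IsRationalClass β → IsRationalClass (f β)) → f * ε = 0 ∨ f * ε = ε) →
        (∃ β, ¬ IsOfHodgeType (2 * (m + 1)) X (2 * (m + 1)) (m + 1) (m + 1) (ε β)) →
        (∃ z : Module.End ℂ (complexBetti X (2 * (m + 1))),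
          IsPrimitiveCentralIdempotent
              (Algebra.adjoin ℂ (Set.range (D.heckeCorrespondenceAction (2 * (m + 1))))) z ∧
            z * ε = z ∧
              ∀ σ : ℂ ≃+* ℂ, ∃ c : complexBetti X (2 * (m + 1)),
                IsOfHodgeType (2 * (m + 1)) X (2 * (m + 1)) (m + 1) (m + 1) (conjEnd σ z c) ∧
                  conjEnd σ z c ≠ 0) →
        ∀ e : complexBetti X (2 * (m + 1)), IsRationalClass e →
          IsOfHodgeType (2 * (m + 1)) X (2 * (m + 1)) (m + 1) (m + 1) e →
          ε e ∈ algebraicClasses X (m + 1)) →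
    AlgebraicOrEnveloped :=
  fun h hcup hCore ↦
    algebraicOrEnveloped_of_coreHodgeClassesAlgebraic_of_pure (algebraicClassesHodge_of_fundamentalClass h) hcup hCore

end Summit.HodgeConjecture.HodgeConjecture.Theorems.EndoscopicMiddleDegreeAlgebraicOrEnvelopedPureConiveau

end
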